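import Mathlib
import HarnessLib
import Literature.RingTheory.CohomologyAnnihilator.StrongGenerator
import Literature.RingTheory.CohomologyAnnihilator.SyzygyBasic
import Literature.RingTheory.CohomologyAnnihilator.TowerBasic

/-!
# Hypersurface periodicity: over `B = S[z]` free of rank `n` over `S` (a power basis), every
# `B`-module that is projective over `S` is a SECOND SYZYGY OF ITSELF

Route `ResolutionOfSingularities/HomologicalConductor`, chain W4.4b, rung S-2 `PersistenceSurface`
(stmt-ResolutionOfSingularities-19970); obligation node `SaturationFourSurface` of
`Theorems/HomologicalConductorPersistenceSurfaceLevelFour.lean` ("`ca(T_m) ⊆ ca⁴(T_m)`; automatic at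
regular and Gorenstein stages") — this file is the HYPERSURFACE instance of the periodicity hypothesis
of `Theorems/HomologicalConductorPersistencePeriodicSaturation.lean`.  [OURS · L1 w44b · res-type-011;
AI-written, weaker than expert review; NOT a statement of the manuscript under study, and no statement of
that manuscript is used.]

**Setting.** `S → B` commutative rings with a power basis `pb` (`B = ⊕_{i<n} S zⁱ`, `z = pb.gen`,
`n = pb.dim ≥ 1`; e.g. `B = S[X]/(f)` for a monic `f` of positive degree, `AdjoinRoot.powerBasis'`),
and `K` a `B`-module.  Write `zⁿ = Σ_{i<n} cᵢ zⁱ` (`cᵢ = pb.basis.repr (zⁿ) i`), `P := B ⊗_S K` with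
its left `B`-structure, `L := z ⊗ 1`, `R := 1 ⊗ z` (two commuting `B`-linear operators on `P`),
`τ := L - R`, `G_j := Σ_{i<j} Lⁱ R^{j-1-i}`, `σ := G_n - Σ cᵢ G_i` ("`Δ(L, R)` for
`f(Y) = Yⁿ - Σ cᵢ Yⁱ = (Y - z)·Δ(Y, z)`"), `μ : P → K` the multiplication and `ι(m) := σ(1 ⊗ m)`.

* `exists_periodic_presentation` — the relative Koszul–Tate / matrix-factorisation exact sequences
  `0 → K —ι→ P —τ→ P —μ→ K → 0` with `range τ = ker μ` and `range ι = ker τ`: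
  `ι` is `B`-linear and injective, `μ` surjective.  Mechanism (coordinates in the power basis,
  `coeff_l : P → K`): `τ G_j = Lʲ - Rʲ` and `G_{j+1} = Lʲ + R G_j` (Mathlib `Commute.mul_geom_sum₂`,
  `Commute.geom_sum₂_succ_eq`) give `τσ = στ = f(L) - f(R) = 0` and the two SPLITTING IDENTITIES
  `τ (q v) + 1 ⊗ μ v = v` and `σ (1 ⊗ coeff_{n-1} v) + q (τ v) = v` for the `S`-linear "division by
  `Y - z`" map `q = Σ_l G_l (1 ⊗ coeff_l ·)`; the top coefficient of `ι m` is `m`.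
* `isSyzygy_two_self` — hence, when `K` is finitely generated over `B` and PROJECTIVE OVER `S`
  (so that `P = B ⊗_S K` is a finitely generated projective `B`-module), `K` is a second syzygy of
  itself: `IsSyzygy 2 K K` (`0 → ker μ → P → K → 0` and `0 → K → P → ker μ → 0`);
  `isSyzygy_two_self_adjoinRoot` — the case `B = S[X]/(f)`, `f` monic of positive degree.

This is Eisenbud's 2-periodicity of maximal Cohen–Macaulay modules over a (relative) hypersurface, in
the tree's `IsSyzygy` vocabulary and with no regularity hypothesis on `S` (projectivity over `S`
replaces "MCM").  Consumed by `…PeriodicSaturation.lean`: `ca(B) = caᵈ⁺¹(B)` when `caᵈ⁺¹(S) = S`.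

References (mechanism only; nothing is cited as a premise): D. Eisenbud, *Homological algebra on a
complete intersection*, Trans. AMS 260 (1980) 35–64, §5–6; S. B. Iyengar, R. Takahashi, IMRN 2016
(arXiv:1404.1476) §2 [`IyengarTakahashi2014`].
-/

noncomputable section

-- single-problem summit: the doubled namespace component `ResolutionOfSingularities` is forced
set_option linter.dupNamespace false

namespace Summit.ResolutionOfSingularities.ResolutionOfSingularities.Theorems.HomologicalConductor.HypersurfacePeriodicity

open CategoryTheory TensorProduct Literature.RingTheory.CohomologyAnnihilator
open scoped TensorProduct

universe u

variable {S : Type u} {B : Type u} [CommRing S] [CommRing B] [Algebra S B]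

/-- **The periodic presentation of a module over a relative hypersurface.** Let `pb` be a power
basis of `B` over `S` of positive rank and `K` a `B`-module. With `P = B ⊗_S K` (left `B`-structure)
there are `B`-linear maps `ι : K → P`, `τ : P → P` and `μ : P → K` (`μ (b ⊗ m) = b • m`,
`τ = z ⊗ 1 - 1 ⊗ z`, `ι m = Δ(z ⊗ 1, 1 ⊗ z)(1 ⊗ m)`) with `ι` injective, `μ` surjective,
`range ι = ker τ` and `range τ = ker μ` — i.e. exact sequences `0 → ker μ → P → K → 0` and
`0 → K → P → ker μ → 0` with the SAME middle term. [OURS; mechanism: Eisenbud 1980 periodicity] -/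
theorem exists_periodic_presentation (pb : PowerBasis S B) (hdim : 0 < pb.dim) (K : Type u)
    [AddCommGroup K] [Module B K] [Module S K] [IsScalarTower S B K] :
    ∃ (ι : K →ₗ[B] B ⊗[S] K) (τ : Module.End B (B ⊗[S] K)) (μ : B ⊗[S] K →ₗ[B] K),
      Function.Injective ι ∧ Function.Surjective μ ∧
        LinearMap.range ι = LinearMap.ker τ ∧ LinearMap.range τ = LinearMap.ker μ := by
  classical
  -- the data of the power basis: `z`, `n`, the relation `zⁿ = Σ cᵢ zⁱ`
  set n := pb.dim with hn_def
  set z := pb.gen with hz_def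
  have hbasis : ∀ i : Fin n, pb.basis i = z ^ (i : ℕ) := fun i => pb.basis_eq_pow i
  let c : Fin n → S := fun i => pb.basis.repr (z ^ n) i
  have hzn : z ^ n = ∑ i : Fin n, c i • z ^ (i : ℕ) := by
    have h := (pb.basis.sum_repr (z ^ n)).symm
    simpa only [hbasis] using h
  -- the two commuting operators `L = z ⊗ 1` and `R = 1 ⊗ z` on `P = B ⊗_S K`
  let L : Module.End B (B ⊗[S] K) := algebraMap B (Module.End B (B ⊗[S] K)) z
  let R : Module.End B (B ⊗[S] K) := (DistribSMul.toLinearMap S K z).baseChange B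
  have hL : ∀ p : B ⊗[S] K, L p = z • p := fun p => rfl
  have hR : ∀ (b : B) (m : K), R (b ⊗ₜ[S] m) = b ⊗ₜ[S] (z • m) := fun b m => by
    simp [R, LinearMap.baseChange_tmul, DistribSMul.toLinearMap_apply]
  have hLR : Commute L R := Algebra.commute_algebraMap_left z R
  have hLpow : ∀ (i : ℕ) (b : B) (m : K), (L ^ i) (b ⊗ₜ[S] m) = (z ^ i * b) ⊗ₜ[S] m :=
    fun i b m => by
    rw [← map_pow]
    change z ^ i • (b ⊗ₜ[S] m) = _
    rw [TensorProduct.smul_tmul', smul_eq_mul]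
  have hRpow : ∀ (i : ℕ) (b : B) (m : K), (R ^ i) (b ⊗ₜ[S] m) = b ⊗ₜ[S] (z ^ i • m) := by
    intro i
    induction i with
    | zero => intro b m; simp
    | succ i ih => intro b m; rw [pow_succ, Module.End.mul_apply, hR, ih, smul_smul, ← pow_succ]
  -- the multiplication map `μ`, the coefficient functionals `coeff l`, the unit section `u`
  let μ : B ⊗[S] K →ₗ[B] K := (LinearMap.id : K →ₗ[S] K).liftBaseChange B
  have hμ : ∀ (b : B) (m : K), μ (b ⊗ₜ[S] m) = b • m := fun b m =>
    LinearMap.liftBaseChange_tmul B _ b m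
  let coeff : Fin n → (B ⊗[S] K →ₗ[S] K) := fun l =>
    (TensorProduct.lid S K).toLinearMap ∘ₗ (pb.basis.coord l).rTensor K
  have hcoeff : ∀ (l : Fin n) (b : B) (m : K), coeff l (b ⊗ₜ[S] m) = pb.basis.repr b l • m :=
    fun l b m => by simp [coeff, LinearMap.rTensor_tmul, Module.Basis.coord]
  have hcoeff_basis : ∀ (l j : Fin n) (m : K),
      coeff l (pb.basis j ⊗ₜ[S] m) = if j = l then m else 0 := fun l j m => by
    rw [hcoeff, pb.basis.repr_self, Finsupp.single_apply]
    split_ifs <;> simp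
  have hcoeff_pow : ∀ (l : Fin n) (i : ℕ) (hi : i < n) (m : K),
      coeff l ((z ^ i) ⊗ₜ[S] m) = if i = (l : ℕ) then m else 0 := fun l i hi m => by
    have := hcoeff_basis l ⟨i, hi⟩ m
    rw [hbasis] at this
    rw [this]
    simp only [Fin.ext_iff]
  let u : K →ₗ[S] B ⊗[S] K := TensorProduct.mk S B K 1
  have hu : ∀ m : K, u m = (1 : B) ⊗ₜ[S] m := fun m => rfl
  -- the geometric sums `G j = Σ_{i<j} Lⁱ R^{j-1-i}`, `τ = L - R`, `σ = G n - Σ cᵢ G i`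
  let G : ℕ → Module.End B (B ⊗[S] K) := fun j =>
    ∑ i ∈ Finset.range j, L ^ i * R ^ (j - 1 - i)
  have hτG : ∀ j, (L - R) * G j = L ^ j - R ^ j := fun j =>
    Commute.mul_geom_sum₂ (R := Module.End B (B ⊗[S] K)) hLR j
  have hGsucc : ∀ j, G (j + 1) = L ^ j + R * G j := fun j =>
    Commute.geom_sum₂_succ_eq (R := Module.End B (B ⊗[S] K)) hLR
  have hG_tmul : ∀ (j : ℕ) (m : K),
      G j ((1 : B) ⊗ₜ[S] m) = ∑ i ∈ Finset.range j, (z ^ i) ⊗ₜ[S] (z ^ (j - 1 - i) • m) := by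
    intro j m
    simp only [G, LinearMap.coe_sum, Finset.sum_apply, Module.End.mul_apply, hRpow, hLpow,
      mul_one]
  have hRG : ∀ j, Commute R (G j) := fun j =>
    Commute.sum_right _ _ _ fun i _ => (hLR.symm.pow_right i).mul_right ((Commute.refl R).pow_right _)
  have hLG : ∀ j, Commute L (G j) := fun j =>
    Commute.sum_right _ _ _ fun i _ => ((Commute.refl L).pow_right i).mul_right (hLR.pow_right _)
  let τ : Module.End B (B ⊗[S] K) := L - R
  let σ : Module.End B (B ⊗[S] K) := G n - ∑ i : Fin n, algebraMap S B (c i) • G i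
  have hτ_apply : ∀ v, τ v = L v - R v := fun v => rfl
  have hσ_apply : ∀ v, σ v = G n v - ∑ i : Fin n, algebraMap S B (c i) • G i v := fun v => by
    simp only [σ, LinearMap.sub_apply, LinearMap.coe_sum, Finset.sum_apply, LinearMap.smul_apply]
  have hτ_tmul : ∀ (b : B) (m : K), τ (b ⊗ₜ[S] m) = (z * b) ⊗ₜ[S] m - b ⊗ₜ[S] (z • m) :=
    fun b m => by rw [hτ_apply, hR, ← pow_one L, hLpow, pow_one]
  -- applied forms of the geometric-sum identities
  have hτG' : ∀ (j : ℕ) (v : B ⊗[S] K), τ (G j v) = (L ^ j) v - (R ^ j) v := fun j v =>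
    congrArg (fun f : Module.End B (B ⊗[S] K) => f v) (hτG j)
  have hGsucc' : ∀ (j : ℕ) (v : B ⊗[S] K), G (j + 1) v = (L ^ j) v + R (G j v) := fun j v =>
    congrArg (fun f : Module.End B (B ⊗[S] K) => f v) (hGsucc j)
  have hGτ : ∀ (j : ℕ) (v : B ⊗[S] K), G j (τ v) = τ (G j v) := fun j v => by
    have h1 := congrArg (fun f : Module.End B (B ⊗[S] K) => f v) (hLG j).eq
    have h2 := congrArg (fun f : Module.End B (B ⊗[S] K) => f v) (hRG j).eq
    simp only [Module.End.mul_apply] at h1 h2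
    rw [hτ_apply, hτ_apply, map_sub, h1, h2]
  -- `Lⁿ = Σ cᵢ Lⁱ` and `Rⁿ = Σ cᵢ Rⁱ` (applied), hence `τ ∘ σ = 0 = σ ∘ τ`
  have hLn : ∀ v : B ⊗[S] K, (L ^ n) v = ∑ i : Fin n, algebraMap S B (c i) • (L ^ (i : ℕ)) v := by
    intro v
    simp only [L, ← map_pow, hzn, map_sum, LinearMap.coe_sum, Finset.sum_apply]
    refine Finset.sum_congr rfl fun i _ => ?_
    rw [Algebra.smul_def, map_mul]
    rfl
  have hRn : ∀ v : B ⊗[S] K, (R ^ n) v = ∑ i : Fin n, algebraMap S B (c i) • (R ^ (i : ℕ)) v := by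
    intro v
    induction v using TensorProduct.induction_on with
    | zero => simp
    | tmul b m =>
      simp only [hRpow, hzn, Finset.sum_smul, TensorProduct.tmul_sum]
      refine Finset.sum_congr rfl fun i _ => ?_
      rw [smul_assoc, TensorProduct.tmul_smul, algebraMap_smul]
    | add v w hv hw =>
      simp only [map_add, hv, hw, smul_add, Finset.sum_add_distrib]
  have hτσ : ∀ v, τ (σ v) = 0 := fun v => by
    rw [hσ_apply, map_sub, map_sum, hτG', hLn, hRn, ← Finset.sum_sub_distrib,
      ← Finset.sum_sub_distrib]
    refine Finset.sum_eq_zero fun i _ => ?_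
    rw [map_smul, hτG', smul_sub, sub_self]
  have hστ : ∀ v, σ (τ v) = 0 := fun v => by
    have : σ (τ v) = τ (σ v) := by
      rw [hσ_apply, hσ_apply, map_sub, map_sum, hGτ]
      refine congrArg _ (Finset.sum_congr rfl fun i _ => ?_)
      rw [map_smul, hGτ]
    rw [this, hτσ]
  -- the last index, `n - 1`
  obtain ⟨k, hk⟩ : ∃ k, n = k + 1 := ⟨n - 1, by omega⟩
  let last : Fin n := ⟨k, by omega⟩
  have hlast : ((last : Fin n) : ℕ) = k := rfl
  -- the division map `q = Σ_l G l ∘ u ∘ coeff l` (`S`-linear)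
  let q : B ⊗[S] K →ₗ[S] B ⊗[S] K := ∑ l : Fin n, (G l).restrictScalars S ∘ₗ u ∘ₗ coeff l
  have hq_apply : ∀ v, q v = ∑ l : Fin n, G l ((1 : B) ⊗ₜ[S] coeff l v) := fun v => by
    simp only [q, LinearMap.coe_sum, Finset.sum_apply, LinearMap.comp_apply,
      LinearMap.restrictScalars_apply, hu]
  have hq_basis : ∀ (j : Fin n) (m : K), q (pb.basis j ⊗ₜ[S] m) = G j ((1 : B) ⊗ₜ[S] m) := by
    intro j m
    rw [hq_apply]
    have h : ∀ l : Fin n, G l ((1 : B) ⊗ₜ[S] coeff l (pb.basis j ⊗ₜ[S] m)) =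
        if j = l then G l ((1 : B) ⊗ₜ[S] m) else 0 := fun l => by
      rw [hcoeff_basis]
      split_ifs <;> simp
    simp only [h, Finset.sum_ite_eq, Finset.mem_univ, if_true]
  have hq_pow : ∀ (i : ℕ) (hi : i < n) (m : K), q ((z ^ i) ⊗ₜ[S] m) = G i ((1 : B) ⊗ₜ[S] m) :=
    fun i hi m => by
    have := hq_basis ⟨i, hi⟩ m
    rwa [hbasis] at this
  -- (S1) the splitting at the `μ`-spot: `τ (q v) + 1 ⊗ μ v = v`
  have hL1 : ∀ (i : ℕ) (m : K), (L ^ i) ((1 : B) ⊗ₜ[S] m) = (z ^ i) ⊗ₜ[S] m := fun i m => by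
    rw [hLpow, mul_one]
  have hS1 : ∀ v : B ⊗[S] K, τ (q v) + (1 : B) ⊗ₜ[S] μ v = v := by
    let F : B ⊗[S] K →ₗ[S] B ⊗[S] K := τ.restrictScalars S ∘ₗ q + u ∘ₗ μ.restrictScalars S
    have hF : ∀ v, F v = τ (q v) + (1 : B) ⊗ₜ[S] μ v := fun v => rfl
    have hFb : ∀ (j : Fin n) (m : K), F (pb.basis j ⊗ₜ[S] m) = pb.basis j ⊗ₜ[S] m := by
      intro j m
      rw [hF, hq_basis, hμ, hτG', hL1, hRpow, hbasis, sub_add_cancel]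
    have hFt : ∀ (b : B) (m : K), F (b ⊗ₜ[S] m) = b ⊗ₜ[S] m := by
      intro b m
      have hb : b ⊗ₜ[S] m = ∑ j : Fin n, pb.basis.repr b j • (pb.basis j ⊗ₜ[S] m) := by
        conv_lhs => rw [← pb.basis.sum_repr b]
        rw [TensorProduct.sum_tmul]
        exact Finset.sum_congr rfl fun j _ => (TensorProduct.smul_tmul' _ _ _).symm
      rw [hb, map_sum]
      exact Finset.sum_congr rfl fun j _ => by rw [map_smul, hFb]
    intro v
    rw [← hF]
    induction v using TensorProduct.induction_on with
    | zero => simp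
    | tmul b m => exact hFt b m
    | add v w hv hw => rw [map_add, hv, hw]
  -- (S2) the splitting at the `τ`-spot: `σ (1 ⊗ coeff_last v) + q (τ v) = v`
  have hRGapp : ∀ (j : ℕ) (v : B ⊗[S] K), R (G j v) = G j (R v) := fun j v => by
    have h := congrArg (fun f : Module.End B (B ⊗[S] K) => f v) (hRG j).eq
    simpa only [Module.End.mul_apply] using h
  have hσ1 : ∀ m : K, σ ((1 : B) ⊗ₜ[S] m) =
      G n ((1 : B) ⊗ₜ[S] m) - ∑ i : Fin n, c i • G i ((1 : B) ⊗ₜ[S] m) := fun m => by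
    rw [hσ_apply]
    simp only [algebraMap_smul]
  have hS2 : ∀ v : B ⊗[S] K, σ ((1 : B) ⊗ₜ[S] coeff last v) + q (τ v) = v := by
    let F : B ⊗[S] K →ₗ[S] B ⊗[S] K :=
      σ.restrictScalars S ∘ₗ u ∘ₗ coeff last + q ∘ₗ τ.restrictScalars S
    have hF : ∀ v, F v = σ ((1 : B) ⊗ₜ[S] coeff last v) + q (τ v) := fun v => rfl
    have hFb : ∀ (j : Fin n) (m : K), F (pb.basis j ⊗ₜ[S] m) = pb.basis j ⊗ₜ[S] m := by
      intro j m
      rw [hF, hcoeff_basis, hbasis, hτ_tmul, map_sub, ← pow_succ', hq_pow (j : ℕ) j.2]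
      by_cases hj : (j : ℕ) + 1 < n
      · -- no wrap-around: `z^{j+1}` is a basis vector
        have hne : ¬ j = last := fun h => by rw [h, hlast] at hj; omega
        rw [if_neg hne, TensorProduct.tmul_zero, map_zero, zero_add, hq_pow _ hj, hGsucc', hRGapp,
          hR, add_sub_cancel_right, hL1]
      · -- wrap-around at the top: `z^{j+1} = zⁿ = Σ cᵢ zⁱ`
        have hjn : (j : ℕ) + 1 = n := by omega
        have hjl : j = last := Fin.ext (by rw [hlast]; omega)
        have hzj : z ^ ((j : ℕ) + 1) = ∑ i : Fin n, c i • z ^ (i : ℕ) := by rw [hjn, hzn]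
        rw [if_pos hjl, hzj, TensorProduct.sum_tmul, map_sum]
        have h2 : ∀ i : Fin n, q ((c i • z ^ (i : ℕ)) ⊗ₜ[S] m) = c i • G i ((1 : B) ⊗ₜ[S] m) :=
          fun i => by rw [← TensorProduct.smul_tmul', map_smul, hq_pow _ i.2]
        simp only [h2]
        have hG' := hGsucc' (j : ℕ) ((1 : B) ⊗ₜ[S] m)
        rw [hjn] at hG'
        rw [hσ1, sub_add_sub_cancel, hG', hRGapp, hR, add_sub_cancel_right, hL1]
    have hFt : ∀ (b : B) (m : K), F (b ⊗ₜ[S] m) = b ⊗ₜ[S] m := by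
      intro b m
      have hb : b ⊗ₜ[S] m = ∑ j : Fin n, pb.basis.repr b j • (pb.basis j ⊗ₜ[S] m) := by
        conv_lhs => rw [← pb.basis.sum_repr b]
        rw [TensorProduct.sum_tmul]
        exact Finset.sum_congr rfl fun j _ => (TensorProduct.smul_tmul' _ _ _).symm
      rw [hb, map_sum]
      exact Finset.sum_congr rfl fun j _ => by rw [map_smul, hFb]
    intro v
    rw [← hF]
    induction v using TensorProduct.induction_on with
    | zero => simp
    | tmul b m => exact hFt b m
    | add v w hv hw => rw [map_add, hv, hw]
  -- `ι m = σ (1 ⊗ m)` is `B`-linear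
  have hσ_smul : ∀ (b : B) (m : K),
      σ ((1 : B) ⊗ₜ[S] (b • m)) = b • σ ((1 : B) ⊗ₜ[S] m) := by
    intro b m
    have h := hS1 (b ⊗ₜ[S] m)
    rw [hμ] at h
    rw [eq_sub_of_add_eq' h, map_sub, hστ, sub_zero,
      show b ⊗ₜ[S] m = b • ((1 : B) ⊗ₜ[S] m) by
        rw [TensorProduct.smul_tmul', smul_eq_mul, mul_one], map_smul]
  let ι : K →ₗ[B] B ⊗[S] K :=
    { toFun := fun m => σ ((1 : B) ⊗ₜ[S] m)
      map_add' := fun m m' => by simp only [TensorProduct.tmul_add, map_add]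
      map_smul' := fun b m => hσ_smul b m }
  have hι : ∀ m, ι m = σ ((1 : B) ⊗ₜ[S] m) := fun m => rfl
  -- the top coefficient of `ι m` is `m`
  have hcoeffG : ∀ (j : ℕ) (hj : j ≤ n) (m : K),
      coeff last (G j ((1 : B) ⊗ₜ[S] m)) = if j = n then m else 0 := by
    intro j hj m
    rw [hG_tmul, map_sum]
    have h : ∀ i ∈ Finset.range j, coeff last ((z ^ i) ⊗ₜ[S] (z ^ (j - 1 - i) • m)) =
        if i = k then z ^ (j - 1 - i) • m else 0 := fun i hi => by
      rw [hcoeff_pow _ _ (by have := Finset.mem_range.mp hi; omega)]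
    rw [Finset.sum_congr rfl h, Finset.sum_ite_eq']
    by_cases hjn : j = n
    · rw [if_pos (Finset.mem_range.mpr (by omega)), if_pos hjn, show j - 1 - k = 0 by omega,
        pow_zero, one_smul]
    · rw [if_neg (fun h' => hjn (by have := Finset.mem_range.mp h'; omega)), if_neg hjn]
  have hcoeffι : ∀ m : K, coeff last (ι m) = m := fun m => by
    rw [hι, hσ1, map_sub, map_sum, hcoeffG n le_rfl, if_pos rfl]
    have h : ∀ i : Fin n, coeff last (c i • G i ((1 : B) ⊗ₜ[S] m)) = 0 := fun i => by
      rw [map_smul, hcoeffG i (le_of_lt i.2), if_neg (ne_of_lt i.2), smul_zero]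
    simp only [h, Finset.sum_const_zero, sub_zero]
  -- conclusion
  refine ⟨ι, τ, μ, ?_, ?_, ?_, ?_⟩
  · -- `ι` injective
    intro m m' h
    have := congrArg (coeff last) h
    rwa [hcoeffι, hcoeffι] at this
  · -- `μ` surjective
    intro m
    exact ⟨(1 : B) ⊗ₜ[S] m, by rw [hμ, one_smul]⟩
  · -- `range ι = ker τ`
    refine le_antisymm ?_ ?_
    · rintro _ ⟨m, rfl⟩
      rw [LinearMap.mem_ker, hι, hτσ]
    · intro v hv
      rw [LinearMap.mem_ker] at hv
      refine ⟨coeff last v, ?_⟩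
      rw [hι]
      have h := hS2 v
      rwa [hv, map_zero, add_zero] at h
  · -- `range τ = ker μ`
    refine le_antisymm ?_ ?_
    · rintro _ ⟨v, rfl⟩
      rw [LinearMap.mem_ker]
      induction v using TensorProduct.induction_on with
      | zero => rw [map_zero, map_zero]
      | tmul b m => rw [hτ_tmul, map_sub, hμ, hμ, mul_smul, smul_comm z b m, sub_self]
      | add v w hv hw => rw [map_add, map_add, hv, hw, add_zero]
    · intro v hv
      rw [LinearMap.mem_ker] at hv
      refine ⟨q v, ?_⟩
      have h := hS1 v
      rwa [hv, TensorProduct.tmul_zero, add_zero] at h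

/-- **Hypersurface periodicity (`IsSyzygy` form).** Over `B` with a power basis of positive rank over
`S`, every finitely generated `B`-module `K` that is PROJECTIVE OVER `S` is a second syzygy of itself:
`IsSyzygy 2 K K` (both defining sequences have middle term the finitely generated projective
`B`-module `B ⊗_S K`). [OURS; mechanism: Eisenbud 1980 periodicity] -/
theorem isSyzygy_two_self (pb : PowerBasis S B) (hdim : 0 < pb.dim) (K : ModuleCat.{u} B)
    [Module S K] [IsScalarTower S B K] [Module.Finite B K] [Module.Projective S K] :
    IsSyzygy 2 K K := by
  obtain ⟨ι, τ, μ, hι, hμ, hιτ, hτμ⟩ := exists_periodic_presentation pb hdim K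
  haveI : Module.Finite S B := Module.Finite.of_basis pb.basis
  haveI : Module.Finite S K := Module.Finite.trans B K
  let P : ModuleCat.{u} B := ModuleCat.of B (B ⊗[S] K)
  have hPfin : Module.Finite B P := inferInstanceAs (Module.Finite B (B ⊗[S] K))
  have hPproj : Projective P :=
    (IsProjective.iff_projective (R := B) (B ⊗[S] K)).mp inferInstance
  let K₁ : ModuleCat.{u} B := ModuleCat.of B (LinearMap.ker μ)
  -- `0 → K₁ → P → K → 0`
  obtain ⟨w₁, hS₁⟩ := exists_shortExact_of_linearMap (Y := K₁) (M := P) (X := K)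
    (LinearMap.ker μ).subtype μ Subtype.val_injective hμ (LinearMap.exact_subtype_ker_map μ)
  -- `0 → K → P → K₁ → 0`
  have hτmem : ∀ v, τ v ∈ LinearMap.ker μ := fun v => hτμ ▸ LinearMap.mem_range_self τ v
  let τ' : (B ⊗[S] K) →ₗ[B] LinearMap.ker μ := LinearMap.codRestrict _ τ hτmem
  have hτ' : Function.Surjective τ' := by
    rintro ⟨w, hw⟩
    rw [← hτμ] at hw
    obtain ⟨v, rfl⟩ := hw
    exact ⟨v, rfl⟩
  have hexact : Function.Exact ι τ' := by
    intro v
    constructor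
    · intro hv
      have hv' : τ v = 0 := congrArg Subtype.val hv
      have : v ∈ LinearMap.range ι := by rw [hιτ]; exact hv'
      obtain ⟨m, rfl⟩ := this
      exact ⟨m, rfl⟩
    · rintro ⟨m, rfl⟩
      apply Subtype.ext
      have : ι m ∈ LinearMap.ker τ := hιτ ▸ LinearMap.mem_range_self ι m
      exact this
  obtain ⟨w₂, hS₂⟩ := exists_shortExact_of_linearMap (Y := K) (M := P) (X := K₁) ι τ' hι hτ'
    hexact
  exact ⟨K₁, P, ⟨K, P, ⟨Iso.refl K⟩, hPfin, hPproj, _, _, w₁, hS₁⟩, hPfin, hPproj, _, _, w₂, hS₂⟩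

/-- **Hypersurface periodicity for `B = S[X]/(f)`**, `f` monic of positive degree: every finitely
generated `B`-module projective over `S` is a second syzygy of itself. [OURS] -/
theorem isSyzygy_two_self_adjoinRoot {f : Polynomial S} (hf : f.Monic) (hf0 : f.natDegree ≠ 0)
    (K : ModuleCat.{u} (AdjoinRoot f)) [Module S K] [IsScalarTower S (AdjoinRoot f) K]
    [Module.Finite (AdjoinRoot f) K] [Module.Projective S K] : IsSyzygy 2 K K :=
  isSyzygy_two_self (AdjoinRoot.powerBasis' hf)
    (by rw [AdjoinRoot.powerBasis'_dim]; exact Nat.pos_of_ne_zero hf0) K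

end Summit.ResolutionOfSingularities.ResolutionOfSingularities.Theorems.HomologicalConductor.HypersurfacePeriodicity

end
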